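import Literature.Barriers.Parity.SiegelZeroDichotomyPairHLTypeICharTools
import Literature.Barriers.Parity.SiegelZeroDichotomyPairHLLemma37General
import Literature.Barriers.Parity.SiegelZeroDichotomyPairHLProp72
import HarnessLib

/-!
# Tao–Teräväinen 2022, §8 (`k = 2`): the `χ`-twisted Type I terms are negligible

Topic `Literature/Barriers/Parity`, sub-namespace `TaoTeravainen`; step (v) of the proof DAG of
`Literature.Barriers.Parity.TaoTeravainen2021_prop72_81_pair` (T. Tao, J. Teräväinen, *The
Hardy–Littlewood–Chowla conjecture in the presence of a Siegel zero*, J. London Math. Soc. (2) 106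
(2022), arXiv:2109.06291), §8, case `ℓ = 0`: "Now suppose that `ℓ = 0`. The above arguments allow
us to dispose of the `g_{d,d'}` contributions in (8.5), leaving us with the task of showing that
`𝔼_{n ≤ x} ∏_{j=1}^k ∑_{d_j ≪ R²(Dq²)²: d_j∣n+h_j} Ψ_{d_j}(n+h_j) ≈ 𝔖`", where "the above arguments"
are those of the case `ℓ > 0`: "From Lemma 3.7(ii) and summation by parts to deal with the
`h_{d₁,…,d'_k}` coefficients, we may thus bound the left-hand side … by
`≪_ε q_χ^{1/2+ε} log^{O(1)} x ∑_J ∑ (d₁⋯d_k,q_χ)^{1/2} τ(d₁)^{O(1)}⋯ (1/(q_χ d₁⋯d_k) + 1/x)`."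
Everything here is PROVED, at `k = 2` with the expansion of
`SiegelZeroDichotomyPairHLTypeIExpansion.lean` (`(χ∗log)♯(m) = A(m) + B(m)`,
`A(m) = ∑_{b∣m} c_b χ(m/b)` the twisted part, `B(m) = ∑_{d∣m} χ(d)Ψ(m/d)` the smooth part):

* `sharpA`, `sharpB`, `sharpLog_eq_sharpA_add_sharpB`; the triple expansions
  `sharpA_mul_selbergSieve_eq`, `sharpB_mul_selbergSieve_eq` over `(b, e, e')`, `(d, e, e')`;
* `abs_cross_le` — the bookkeeping `∑_{t₁,t₂} |c₁c₂| √(([t₁][t₂],q)) (x/(q[t₁][t₂]) + 1)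
  ≤ K₁K₂K ((x/q) S₁ S₂ + √q #T₁ #T₂)`;
* the three cross terms `AA`, `AB`, `BA` bounded by Lemma 3.7 (`TaoTeravainen2021_lemma37_general`
  with `J = {h₁,h₂}`, `{h₁}`, `{h₂}`) and summation by parts (`abs_sum_mul_psiSharp_le`), and
* **`abs_sharpCorr_sub_smooth_le`** — `|∑_{n ≤ x} Λ♯(n+h₁)Λ♯(n+h₂) - ∑_{n ≤ x} (Bν)(n+h₁)(Bν)(n+h₂)|
  ≤ C q^{1/2+ε} X⁴-type · ((x/q) τ(q)⁸ (1 + log Y)¹⁶ + √q N²)`.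
  [cite: TaoTeravainen2021, §8 (the case `ℓ > 0`, and the disposal of the `g_{d,d'}` terms for `ℓ = 0`)]
-/

noncomputable section

open Finset Real MeasureTheory
open scoped ContDiff Topology

namespace Literature.Barriers.Parity

namespace TaoTeravainen

variable {q : ℕ}

/-! ### The twisted part `A` and the smooth part `B` of `(χ∗log)♯` -/

/-- `A(m) := ∑_{b ≤ B_max, b ∣ m} c_b χ(m/b)`. [cite: TaoTeravainen2021, §8 (the terms `c_d χ(n/d)`)] -/
def sharpA (χ : DirichletCharacter ℂ q) (φ ψ : ℝ → ℝ) (X U₀ : ℝ) (Bmax m : ℕ) : ℝ :=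
  ∑ b ∈ Icc 1 Bmax, if b ∣ m then sharpLogCoeff φ ψ X U₀ b * realChar χ (m / b) else 0

/-- `B(m) := ∑_{d ≤ D_max, d ∣ m} χ(d) Ψ(m/d)`. [cite: TaoTeravainen2021, §8 (the terms `Ψ(n/d)χ(d)`)] -/
def sharpB (χ : DirichletCharacter ℂ q) (φ ψ : ℝ → ℝ) (X U₀ : ℝ) (Dmax m : ℕ) : ℝ :=
  ∑ d ∈ Icc 1 Dmax, if d ∣ m then realChar χ d * psiSharp φ ψ X U₀ ((m : ℝ) / d) else 0

/-- **`(χ∗log)♯ = A + B`** for `1 ≤ m`, `log m ≤ X + U₀ - 1`, when `B_max` exceeds the support of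
`c_b` (`U₀ + 1 ≤ log b` for `b > B_max`) and `D_max` that of `d ↦ Ψ(m/d)`
(`log(m/d) ≤ X - 2U₀ - 1` for `d > D_max`, `d ∣ m`). [cite: TaoTeravainen2021, §8] -/
theorem sharpLog_eq_sharpA_add_sharpB (χ : DirichletCharacter ℂ q) {φ ψ : ℝ → ℝ} (hφ : IsBump φ)
    (hψ : IsSmoothCutoff ψ) {X U₀ : ℝ} (hU₀ : 0 < U₀) (hX : 2 * U₀ ≤ X) {m : ℕ} (hm : 1 ≤ m)
    (hmX : Real.log m ≤ X + U₀ - 1) {Bmax Dmax : ℕ} (hB : ∀ b : ℕ, Bmax < b → U₀ + 1 ≤ Real.log b)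
    (hD : ∀ d ∈ m.divisors, Dmax < d → Real.log ((m : ℝ) / d) ≤ X - 2 * U₀ - 1) :
    sharpLog χ φ ψ X U₀ m = sharpA χ φ ψ X U₀ Bmax m + sharpB χ φ ψ X U₀ Dmax m := by
  have hm0 : m ≠ 0 := by omega
  rw [sharpLog_eq_sum χ hφ hψ hU₀ hX hm hmX]
  simp_rw [mul_add]
  rw [sum_add_distrib]
  congr 1
  · -- the twisted part, summed over `b = p.2`
    rw [Nat.sum_divisorsAntidiagonal' (f := fun a b => realChar χ a * sharpLogCoeff φ ψ X U₀ b)]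
    unfold sharpA
    rw [sum_divisors_eq_sum_Icc_filter hm0 (g := fun b => realChar χ (m / b) * sharpLogCoeff φ ψ X U₀ b)
      (Y := Bmax) fun b _ hb => by rw [sharpLogCoeff_eq_zero hφ ψ X (hB b hb), mul_zero]]
    refine sum_congr rfl fun b _ => ?_
    split_ifs <;> ring
  · -- the smooth part, summed over `d = p.1`
    rw [Nat.sum_divisorsAntidiagonal (f := fun a b => realChar χ a * psiSharp φ ψ X U₀ b)]
    unfold sharpB
    rw [sum_divisors_eq_sum_Icc_filter hm0 (g := fun d => realChar χ d * psiSharp φ ψ X U₀ ((m / d : ℕ) : ℝ))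
      (Y := Dmax) fun d hd hDd => ?_]
    · refine sum_congr rfl fun d hd => ?_
      split_ifs with hdm
      · rw [Nat.cast_div hdm (by rw [mem_Icc] at hd; exact_mod_cast (show d ≠ 0 by omega))]
      · rfl
    · rw [Nat.cast_div (Nat.dvd_of_mem_divisors hd) (by exact_mod_cast (Nat.pos_of_mem_divisors hd).ne'),
        psiSharp_eq_zero hφ hψ hU₀ (hD d hd hDd), mul_zero]

/-! ### The triple expansions of `Aν` and `Bν` -/

/-- The triples `(b, e, e')`: `b ≤ N`, `e, e' ∈ sieveRange R`. [cite: TaoTeravainen2021, §8] -/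
def sharpTriples (R : ℝ) (N : ℕ) : Finset (ℕ × ℕ × ℕ) := Icc 1 N ×ˢ (sieveRange R ×ˢ sieveRange R)

/-- Members of `sharpTriples`. [folklore] -/
theorem mem_sharpTriples {R : ℝ} {N : ℕ} {t : ℕ × ℕ × ℕ} :
    t ∈ sharpTriples R N ↔ (1 ≤ t.1 ∧ t.1 ≤ N) ∧ t.2.1 ∈ sieveRange R ∧ t.2.2 ∈ sieveRange R := by
  unfold sharpTriples
  rw [mem_product, mem_product, mem_Icc]

/-- `b ∣ m ∧ (e ∣ m ∧ e' ∣ m) ↔ [b,[e,e']] ∣ m`. [folklore] -/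
theorem dvd_and_dvd_iff_tripleLcm (t : ℕ × ℕ × ℕ) (m : ℕ) :
    (t.1 ∣ m ∧ (t.2.1 ∣ m ∧ t.2.2 ∣ m)) ↔ tripleLcm t ∣ m := by
  unfold tripleLcm
  rw [Nat.lcm_dvd_iff, Nat.lcm_dvd_iff]

/-- **`A(m)ν(m) = ∑_{(b,e,e')} c_b λ_e λ_{e'} 1_{[b,[e,e']]∣m} χ(m/b)`** (`m ≠ 0`, `R > 1`).
[cite: TaoTeravainen2021, §8] -/
theorem sharpA_mul_selbergSieve_eq (χ : DirichletCharacter ℂ q) (φ : ℝ → ℝ) {ψ : ℝ → ℝ}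
    (hψ : IsSmoothCutoff ψ) (X U₀ : ℝ) {R : ℝ} (hR : 1 < R) (Bmax : ℕ) {m : ℕ} (hm : m ≠ 0) :
    sharpA χ φ ψ X U₀ Bmax m * selbergSieve ψ R m =
      ∑ t ∈ sharpTriples R Bmax, sharpLogCoeff φ ψ X U₀ t.1 * sieveWt ψ R t.2.1 * sieveWt ψ R t.2.2 *
        (if tripleLcm t ∣ m then realChar χ (m / t.1) else 0) := by
  unfold sharpA sharpTriples
  rw [selbergSieve_eq_double_sum hψ hR hm, sum_mul_sum, sum_product]
  refine sum_congr rfl fun b _ => ?_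
  rw [sum_product]
  refine sum_congr rfl fun e _ => ?_
  rw [mul_sum]
  refine sum_congr rfl fun e' _ => ?_
  simp only [← dvd_and_dvd_iff_tripleLcm]
  by_cases h1 : b ∣ m <;> by_cases h2 : e ∣ m ∧ e' ∣ m <;> simp [h1, h2, mul_assoc, mul_comm]

/-- **`B(m)ν(m) = ∑_{(d,e,e')} χ(d) λ_e λ_{e'} 1_{[d,[e,e']]∣m} Ψ(m/d)`** (`m ≠ 0`, `R > 1`).
[cite: TaoTeravainen2021, §8] -/
theorem sharpB_mul_selbergSieve_eq (χ : DirichletCharacter ℂ q) (φ : ℝ → ℝ) {ψ : ℝ → ℝ}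
    (hψ : IsSmoothCutoff ψ) (X U₀ : ℝ) {R : ℝ} (hR : 1 < R) (Dmax : ℕ) {m : ℕ} (hm : m ≠ 0) :
    sharpB χ φ ψ X U₀ Dmax m * selbergSieve ψ R m =
      ∑ t ∈ sharpTriples R Dmax, realChar χ t.1 * sieveWt ψ R t.2.1 * sieveWt ψ R t.2.2 *
        ((if tripleLcm t ∣ m then (1 : ℝ) else 0) * psiSharp φ ψ X U₀ ((m : ℝ) / t.1)) := by
  unfold sharpB sharpTriples
  rw [selbergSieve_eq_double_sum hψ hR hm, sum_mul_sum, sum_product]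
  refine sum_congr rfl fun d _ => ?_
  rw [sum_product]
  refine sum_congr rfl fun e _ => ?_
  rw [mul_sum]
  refine sum_congr rfl fun e' _ => ?_
  simp only [← dvd_and_dvd_iff_tripleLcm]
  by_cases h1 : d ∣ m <;> by_cases h2 : e ∣ m ∧ e' ∣ m <;> simp [h1, h2, mul_assoc, mul_comm]

/-! ### Generic bookkeeping for a cross term -/

/-- Exchanging the `n`-sum with the two triple sums. [folklore] -/
theorem sum_mul_sum_eq_sum_sum {ι κ : Type*} (S : Finset ℕ) (T₁ : Finset ι) (T₂ : Finset κ)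
    (c₁ : ι → ℝ) (c₂ : κ → ℝ) (F : ι → ℕ → ℝ) (G : κ → ℕ → ℝ) :
    ∑ n ∈ S, (∑ t₁ ∈ T₁, c₁ t₁ * F t₁ n) * (∑ t₂ ∈ T₂, c₂ t₂ * G t₂ n) =
      ∑ t₁ ∈ T₁, ∑ t₂ ∈ T₂, c₁ t₁ * c₂ t₂ * ∑ n ∈ S, F t₁ n * G t₂ n := by
  simp_rw [sum_mul_sum, mul_sum]
  rw [sum_comm]
  refine sum_congr rfl fun t₁ _ => ?_
  rw [sum_comm]
  refine sum_congr rfl fun t₂ _ => sum_congr rfl fun n _ => by ring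

/-- **The cross-term bookkeeping**: if `|I(t₁,t₂)| ≤ K √(([t₁][t₂], q)) (x/(q [t₁][t₂]) + 1)`,
`|c₁| ≤ K₁`, `|c₂| ≤ K₂`, then
`|∑_{t₁,t₂} c₁ c₂ I| ≤ K₁ K₂ K ((x/q) S₁ S₂ + √q #T₁ #T₂)`, `S_i = ∑_{t ∈ T_i} √(([t],q))/[t]`
("which on evaluating the `d'_j` sums … can be bounded by
`≪_ε q_χ^{1/2+ε} log^{O(1)} x ∑_d (d,q_χ)^{1/2} τ(d)^{O(1)} (1/(q_χ d) + 1/x)`").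
[cite: TaoTeravainen2021, §8] -/
theorem abs_cross_le {q : ℕ} (hq : q ≠ 0) (T₁ T₂ : Finset (ℕ × ℕ × ℕ)) (c₁ c₂ : ℕ × ℕ × ℕ → ℝ)
    (I : ℕ × ℕ × ℕ → ℕ × ℕ × ℕ → ℝ) {K K₁ K₂ x : ℝ} (hK : 0 ≤ K) (hK₁ : 0 ≤ K₁) (hK₂ : 0 ≤ K₂) (hx : 0 ≤ x)
    (hc₁ : ∀ t ∈ T₁, |c₁ t| ≤ K₁) (hc₂ : ∀ t ∈ T₂, |c₂ t| ≤ K₂)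
    (hL₁ : ∀ t ∈ T₁, 1 ≤ tripleLcm t) (hL₂ : ∀ t ∈ T₂, 1 ≤ tripleLcm t)
    (hI : ∀ t₁ ∈ T₁, ∀ t₂ ∈ T₂, |I t₁ t₂| ≤ K * Real.sqrt (Nat.gcd (tripleLcm t₁ * tripleLcm t₂) q) *
      (x / ((q : ℝ) * tripleLcm t₁ * tripleLcm t₂) + 1)) :
    |∑ t₁ ∈ T₁, ∑ t₂ ∈ T₂, c₁ t₁ * c₂ t₂ * I t₁ t₂| ≤
      K₁ * K₂ * K * (x / q * (∑ t ∈ T₁, Real.sqrt (Nat.gcd (tripleLcm t) q) / tripleLcm t) *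
        (∑ t ∈ T₂, Real.sqrt (Nat.gcd (tripleLcm t) q) / tripleLcm t) + Real.sqrt q * #T₁ * #T₂) := by
  have hq0 : (0 : ℝ) < q := by exact_mod_cast Nat.pos_of_ne_zero hq
  -- termwise
  have hterm : ∀ t₁ ∈ T₁, ∀ t₂ ∈ T₂, |c₁ t₁ * c₂ t₂ * I t₁ t₂| ≤
      K₁ * K₂ * K * (x / q * (Real.sqrt (Nat.gcd (tripleLcm t₁) q) / tripleLcm t₁ *
        (Real.sqrt (Nat.gcd (tripleLcm t₂) q) / tripleLcm t₂)) + Real.sqrt q) := by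
    intro t₁ ht₁ t₂ ht₂
    have hL1 : (1 : ℝ) ≤ tripleLcm t₁ := by exact_mod_cast hL₁ t₁ ht₁
    have hL2 : (1 : ℝ) ≤ tripleLcm t₂ := by exact_mod_cast hL₂ t₂ ht₂
    rw [abs_mul, abs_mul]
    refine (mul_le_mul (mul_le_mul (hc₁ t₁ ht₁) (hc₂ t₂ ht₂) (abs_nonneg _) hK₁) (hI t₁ ht₁ t₂ ht₂)
      (abs_nonneg _) (by positivity)).trans ?_
    -- `√((L₁L₂,q)) ≤ √((L₁,q)) √((L₂,q))` and `≤ √q`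
    have hg12 : Real.sqrt (Nat.gcd (tripleLcm t₁ * tripleLcm t₂) q) ≤
        Real.sqrt (Nat.gcd (tripleLcm t₁) q) * Real.sqrt (Nat.gcd (tripleLcm t₂) q) := by
      rw [← Real.sqrt_mul (Nat.cast_nonneg _)]
      refine Real.sqrt_le_sqrt ?_
      have h := Nat.gcd_mul_right_dvd_mul_gcd q (tripleLcm t₁) (tripleLcm t₂)
      rw [Nat.gcd_comm q, Nat.gcd_comm q, Nat.gcd_comm q] at h
      have hpos : 0 < Nat.gcd (tripleLcm t₁) q * Nat.gcd (tripleLcm t₂) q :=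
        Nat.mul_pos (Nat.gcd_pos_of_pos_right _ (Nat.pos_of_ne_zero hq)) (Nat.gcd_pos_of_pos_right _ (Nat.pos_of_ne_zero hq))
      exact_mod_cast Nat.le_of_dvd hpos h
    have hgq : Real.sqrt (Nat.gcd (tripleLcm t₁ * tripleLcm t₂) q) ≤ Real.sqrt q :=
      Real.sqrt_le_sqrt (by exact_mod_cast Nat.gcd_le_right _ (Nat.pos_of_ne_zero hq))
    have hsplit : Real.sqrt (Nat.gcd (tripleLcm t₁ * tripleLcm t₂) q) *
        (x / ((q : ℝ) * tripleLcm t₁ * tripleLcm t₂) + 1) ≤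
        x / q * (Real.sqrt (Nat.gcd (tripleLcm t₁) q) / tripleLcm t₁ *
          (Real.sqrt (Nat.gcd (tripleLcm t₂) q) / tripleLcm t₂)) + Real.sqrt q := by
      rw [mul_add, mul_one]
      refine add_le_add ?_ hgq
      calc Real.sqrt (Nat.gcd (tripleLcm t₁ * tripleLcm t₂) q) * (x / ((q : ℝ) * tripleLcm t₁ * tripleLcm t₂))
          ≤ (Real.sqrt (Nat.gcd (tripleLcm t₁) q) * Real.sqrt (Nat.gcd (tripleLcm t₂) q)) *
            (x / ((q : ℝ) * tripleLcm t₁ * tripleLcm t₂)) :=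
            mul_le_mul_of_nonneg_right hg12 (by positivity)
        _ = _ := by field_simp
    calc K₁ * K₂ * (K * Real.sqrt (Nat.gcd (tripleLcm t₁ * tripleLcm t₂) q) *
          (x / ((q : ℝ) * tripleLcm t₁ * tripleLcm t₂) + 1))
        = K₁ * K₂ * K * (Real.sqrt (Nat.gcd (tripleLcm t₁ * tripleLcm t₂) q) *
          (x / ((q : ℝ) * tripleLcm t₁ * tripleLcm t₂) + 1)) := by ring
      _ ≤ _ := mul_le_mul_of_nonneg_left hsplit (by positivity)
  calc |∑ t₁ ∈ T₁, ∑ t₂ ∈ T₂, c₁ t₁ * c₂ t₂ * I t₁ t₂|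
      ≤ ∑ t₁ ∈ T₁, ∑ t₂ ∈ T₂, |c₁ t₁ * c₂ t₂ * I t₁ t₂| :=
        (abs_sum_le_sum_abs _ _).trans (sum_le_sum fun t₁ _ => abs_sum_le_sum_abs _ _)
    _ ≤ ∑ t₁ ∈ T₁, ∑ t₂ ∈ T₂, K₁ * K₂ * K * (x / q * (Real.sqrt (Nat.gcd (tripleLcm t₁) q) / tripleLcm t₁ *
        (Real.sqrt (Nat.gcd (tripleLcm t₂) q) / tripleLcm t₂)) + Real.sqrt q) :=
        sum_le_sum fun t₁ ht₁ => sum_le_sum fun t₂ ht₂ => hterm t₁ ht₁ t₂ ht₂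
    _ = _ := by
        have e1 : ∑ t₁ ∈ T₁, ∑ t₂ ∈ T₂, K₁ * K₂ * K * (x / q * (Real.sqrt (Nat.gcd (tripleLcm t₁) q) / tripleLcm t₁ *
            (Real.sqrt (Nat.gcd (tripleLcm t₂) q) / tripleLcm t₂))) =
            K₁ * K₂ * K * (x / q * ((∑ t ∈ T₁, Real.sqrt (Nat.gcd (tripleLcm t) q) / tripleLcm t) *
              (∑ t ∈ T₂, Real.sqrt (Nat.gcd (tripleLcm t) q) / tripleLcm t))) := by
          rw [sum_mul_sum]
          simp only [mul_sum]
        have e2 : ∑ _t₁ ∈ T₁, ∑ _t₂ ∈ T₂, K₁ * K₂ * K * Real.sqrt q = K₁ * K₂ * K * (Real.sqrt q * #T₁ * #T₂) := by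
          rw [sum_const, sum_const, nsmul_eq_mul, nsmul_eq_mul]; ring
        simp_rw [mul_add, sum_add_distrib]
        rw [e1, e2]; ring

/-! ### Lemma 3.7 for the pair of shifts, three configurations -/

/-- The translation of `1_{∀ h ∈ {h₁,h₂}, d_h ∣ n+h} ∏_{h ∈ J} χ((n+h)/d'_h)` to explicit form. [folklore] -/
theorem pair_system_iff {h₁ h₂ : ℕ} (hne : h₁ ≠ h₂) (L₁ L₂ n : ℕ) :
    (∀ h ∈ ({h₁, h₂} : Finset ℕ), (if h = h₁ then L₁ else L₂) ∣ n + h) ↔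
      (L₁ ∣ n + h₁ ∧ L₂ ∣ n + h₂) := by
  simp only [Finset.forall_mem_insert, Finset.mem_singleton, forall_eq, if_true, if_neg hne.symm]

/-- **Lemma 3.7, `J = {h₁, h₂}`**: `∃ C ≥ 0`, for every Siegel zero, `x`, `b_j ∣ L_j` (`L_j ≥ 1`):
`|∑_{n ≤ x} 1_{L₁∣n+h₁, L₂∣n+h₂} χ((n+h₁)/b₁)χ((n+h₂)/b₂)| ≤ C q^{1/2+ε} √((L₁L₂,q)) (x/(qL₁L₂) + 1)`.
[cite: TaoTeravainen2021, Lemma 3.7] -/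
theorem lemma37_pair_both {h₁ h₂ : ℕ} (hh₁ : 1 ≤ h₁) (hh₂ : 1 ≤ h₂) (hne : h₁ ≠ h₂) {ε : ℝ} (hε : 0 < ε) :
    ∃ C : ℝ, 0 ≤ C ∧ ∀ (q : ℕ) [NeZero q] (χ : DirichletCharacter ℂ q) (η : ℝ), IsSiegelZero χ η →
      ∀ (x L₁ L₂ b₁ b₂ : ℕ), 1 ≤ L₁ → 1 ≤ L₂ → b₁ ∣ L₁ → b₂ ∣ L₂ →
        |∑ n ∈ Icc 1 x, (if L₁ ∣ n + h₁ ∧ L₂ ∣ n + h₂ then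
            realChar χ ((n + h₁) / b₁) * realChar χ ((n + h₂) / b₂) else 0)| ≤
          C * (q : ℝ) ^ ((1 : ℝ) / 2 + ε) * Real.sqrt (Nat.gcd (L₁ * L₂) q) *
            ((x : ℝ) / ((q : ℝ) * L₁ * L₂) + 1) := by
  classical
  obtain ⟨C, hC0, hC⟩ := TaoTeravainen2021_lemma37_general {h₁, h₂} {h₁, h₂} ⟨h₁, mem_insert_self _ _⟩
    (subset_refl _) (by
      intro h hh; rw [mem_insert, mem_singleton] at hh
      rcases hh with rfl | rfl <;> assumption) hε
  refine ⟨C, hC0, fun q _ χ η hS x L₁ L₂ b₁ b₂ hL₁ hL₂ hb₁ hb₂ => ?_⟩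
  have h := hC q χ η hS x (fun h => if h = h₁ then L₁ else L₂) (fun h => if h = h₁ then b₁ else b₂)
    (by intro h _; split_ifs <;> assumption)
    (by intro h _; split_ifs <;> assumption)
  rw [prod_pair hne, prod_pair hne] at h
  simp only [if_true, if_neg hne.symm] at h
  have hsum : ∑ n ∈ Icc 1 x, (if L₁ ∣ n + h₁ ∧ L₂ ∣ n + h₂ then
      realChar χ ((n + h₁) / b₁) * realChar χ ((n + h₂) / b₂) else 0) =
      ∑ n ∈ Icc 1 x, (if ∀ h ∈ ({h₁, h₂} : Finset ℕ), (if h = h₁ then L₁ else L₂) ∣ n + h then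
        ∏ h ∈ ({h₁, h₂} : Finset ℕ), realChar χ ((n + h) / if h = h₁ then b₁ else b₂) else 0) :=
    sum_congr rfl fun n _ => by rw [prod_pair hne]; simp only [pair_system_iff hne, if_true, if_neg hne.symm]
  rw [hsum, show (q : ℝ) * L₁ * L₂ = q * (L₁ * L₂) by ring]
  exact h

/-- **Lemma 3.7, `J = {h₁}`**. [cite: TaoTeravainen2021, Lemma 3.7] -/
theorem lemma37_pair_left {h₁ h₂ : ℕ} (hh₁ : 1 ≤ h₁) (hh₂ : 1 ≤ h₂) (hne : h₁ ≠ h₂) {ε : ℝ} (hε : 0 < ε) :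
    ∃ C : ℝ, 0 ≤ C ∧ ∀ (q : ℕ) [NeZero q] (χ : DirichletCharacter ℂ q) (η : ℝ), IsSiegelZero χ η →
      ∀ (x L₁ L₂ b₁ : ℕ), 1 ≤ L₁ → 1 ≤ L₂ → b₁ ∣ L₁ →
        |∑ n ∈ Icc 1 x, (if L₁ ∣ n + h₁ ∧ L₂ ∣ n + h₂ then realChar χ ((n + h₁) / b₁) else 0)| ≤
          C * (q : ℝ) ^ ((1 : ℝ) / 2 + ε) * Real.sqrt (Nat.gcd (L₁ * L₂) q) *
            ((x : ℝ) / ((q : ℝ) * L₁ * L₂) + 1) := by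
  classical
  obtain ⟨C, hC0, hC⟩ := TaoTeravainen2021_lemma37_general {h₁, h₂} {h₁} ⟨h₁, mem_singleton_self _⟩
    (by intro h hh; rw [mem_singleton] at hh; rw [hh]; exact mem_insert_self _ _) (by
      intro h hh; rw [mem_insert, mem_singleton] at hh
      rcases hh with rfl | rfl <;> assumption) hε
  refine ⟨C, hC0, fun q _ χ η hS x L₁ L₂ b₁ hL₁ hL₂ hb₁ => ?_⟩
  have h := hC q χ η hS x (fun h => if h = h₁ then L₁ else L₂) (fun _ => b₁)
    (by intro h _; split_ifs <;> assumption)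
    (by intro h hh; rw [mem_singleton] at hh; subst hh; simp only [if_true]; exact hb₁)
  rw [prod_pair hne, prod_pair hne] at h
  simp only [if_true, if_neg hne.symm, prod_singleton] at h
  have hsum : ∑ n ∈ Icc 1 x, (if L₁ ∣ n + h₁ ∧ L₂ ∣ n + h₂ then realChar χ ((n + h₁) / b₁) else 0) =
      ∑ n ∈ Icc 1 x, (if ∀ h ∈ ({h₁, h₂} : Finset ℕ), (if h = h₁ then L₁ else L₂) ∣ n + h then
        realChar χ ((n + h₁) / b₁) else 0) :=
    sum_congr rfl fun n _ => by simp only [pair_system_iff hne]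
  rw [hsum, show (q : ℝ) * L₁ * L₂ = q * (L₁ * L₂) by ring]
  exact h

/-- **Lemma 3.7, `J = {h₂}`**. [cite: TaoTeravainen2021, Lemma 3.7] -/
theorem lemma37_pair_right {h₁ h₂ : ℕ} (hh₁ : 1 ≤ h₁) (hh₂ : 1 ≤ h₂) (hne : h₁ ≠ h₂) {ε : ℝ} (hε : 0 < ε) :
    ∃ C : ℝ, 0 ≤ C ∧ ∀ (q : ℕ) [NeZero q] (χ : DirichletCharacter ℂ q) (η : ℝ), IsSiegelZero χ η →
      ∀ (x L₁ L₂ b₂ : ℕ), 1 ≤ L₁ → 1 ≤ L₂ → b₂ ∣ L₂ →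
        |∑ n ∈ Icc 1 x, (if L₁ ∣ n + h₁ ∧ L₂ ∣ n + h₂ then realChar χ ((n + h₂) / b₂) else 0)| ≤
          C * (q : ℝ) ^ ((1 : ℝ) / 2 + ε) * Real.sqrt (Nat.gcd (L₁ * L₂) q) *
            ((x : ℝ) / ((q : ℝ) * L₁ * L₂) + 1) := by
  classical
  obtain ⟨C, hC0, hC⟩ := TaoTeravainen2021_lemma37_general {h₁, h₂} {h₂} ⟨h₂, mem_singleton_self _⟩
    (by intro h hh; rw [mem_singleton] at hh; rw [hh, mem_insert, mem_singleton]; exact Or.inr rfl) (by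
      intro h hh; rw [mem_insert, mem_singleton] at hh
      rcases hh with rfl | rfl <;> assumption) hε
  refine ⟨C, hC0, fun q _ χ η hS x L₁ L₂ b₂ hL₁ hL₂ hb₂ => ?_⟩
  have h := hC q χ η hS x (fun h => if h = h₁ then L₁ else L₂) (fun _ => b₂)
    (by intro h _; split_ifs <;> assumption)
    (by intro h hh; rw [mem_singleton] at hh; subst hh; simp only [if_neg hne.symm]; exact hb₂)
  rw [prod_pair hne, prod_pair hne] at h
  simp only [if_true, if_neg hne.symm, prod_singleton] at h
  have hsum : ∑ n ∈ Icc 1 x, (if L₁ ∣ n + h₁ ∧ L₂ ∣ n + h₂ then realChar χ ((n + h₂) / b₂) else 0) =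
      ∑ n ∈ Icc 1 x, (if ∀ h ∈ ({h₁, h₂} : Finset ℕ), (if h = h₁ then L₁ else L₂) ∣ n + h then
        realChar χ ((n + h₂) / b₂) else 0) :=
    sum_congr rfl fun n _ => by simp only [pair_system_iff hne]
  rw [hsum, show (q : ℝ) * L₁ * L₂ = q * (L₁ * L₂) by ring]
  exact h


/-! ### The three cross terms -/

/-- The sum `S(T) = ∑_{t ∈ T} √(([t], q))/[t]`. [cite: TaoTeravainen2021, §8] -/
def tripleGcdSum (q : ℕ) (T : Finset (ℕ × ℕ × ℕ)) : ℝ :=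
  ∑ t ∈ T, Real.sqrt (Nat.gcd (tripleLcm t) q) / tripleLcm t

/-- `S(T) ≥ 0`. [folklore] -/
theorem tripleGcdSum_nonneg (q : ℕ) (T : Finset (ℕ × ℕ × ℕ)) : 0 ≤ tripleGcdSum q T :=
  sum_nonneg fun _ _ => by positivity

/-- Components and `lcm` of a triple in `sharpTriples R N` are `≥ 1`. [folklore] -/
theorem one_le_of_mem_sharpTriples {R : ℝ} {N : ℕ} {t : ℕ × ℕ × ℕ} (ht : t ∈ sharpTriples R N) :
    1 ≤ t.1 ∧ 1 ≤ t.2.1 ∧ 1 ≤ t.2.2 ∧ 1 ≤ tripleLcm t := by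
  rw [mem_sharpTriples, mem_sieveRange, mem_sieveRange] at ht
  refine ⟨ht.1.1, ht.2.1.1, ht.2.2.1, ?_⟩
  exact Nat.pos_of_ne_zero (Nat.lcm_ne_zero (by linarith [ht.1.1]) (Nat.lcm_ne_zero (by linarith [ht.2.1.1])
    (by linarith [ht.2.2.1])))

/-- **The `AA` term**: with a Lemma 3.7–type bound `K` for `J = {h₁,h₂}`,
`|∑_{n ≤ x} (Aν)(n+h₁)(Aν)(n+h₂)| ≤ (C_c B_ψ²)² K ((x/q) S_A² + √q #T_A²)`.
[cite: TaoTeravainen2021, §8] -/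
theorem abs_crossAA_le (χ : DirichletCharacter ℂ q) [NeZero q] (φ : ℝ → ℝ) {ψ : ℝ → ℝ} (hψ : IsSmoothCutoff ψ)
    {Bψ : ℝ} (hBψ : ∀ u, |ψ u| ≤ Bψ) (X U₀ : ℝ) {Cc : ℝ} (hCc0 : 0 ≤ Cc)
    (hCc : ∀ b : ℕ, 1 ≤ b → |sharpLogCoeff φ ψ X U₀ b| ≤ Cc) {R : ℝ} (hR : 1 < R) (x : ℕ) {h₁ h₂ : ℕ}
    (Bmax : ℕ) {K : ℝ} (hK : 0 ≤ K)
    (h37 : ∀ (L₁ L₂ b₁ b₂ : ℕ), 1 ≤ L₁ → 1 ≤ L₂ → b₁ ∣ L₁ → b₂ ∣ L₂ →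
      |∑ n ∈ Icc 1 x, (if L₁ ∣ n + h₁ ∧ L₂ ∣ n + h₂ then
          realChar χ ((n + h₁) / b₁) * realChar χ ((n + h₂) / b₂) else 0)| ≤
        K * Real.sqrt (Nat.gcd (L₁ * L₂) q) * ((x : ℝ) / ((q : ℝ) * L₁ * L₂) + 1)) :
    |∑ n ∈ Icc 1 x, (sharpA χ φ ψ X U₀ Bmax (n + h₁) * selbergSieve ψ R (n + h₁)) *
        (sharpA χ φ ψ X U₀ Bmax (n + h₂) * selbergSieve ψ R (n + h₂))| ≤
      (Cc * Bψ ^ 2) * (Cc * Bψ ^ 2) * K * ((x : ℝ) / q * tripleGcdSum q (sharpTriples R Bmax) *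
        tripleGcdSum q (sharpTriples R Bmax) + Real.sqrt q * #(sharpTriples R Bmax) * #(sharpTriples R Bmax)) := by
  have hq : q ≠ 0 := NeZero.ne q
  have hBψ0 : 0 ≤ Bψ := (abs_nonneg _).trans (hBψ 0)
  set T := sharpTriples R Bmax with hT
  set c : ℕ × ℕ × ℕ → ℝ := fun t => sharpLogCoeff φ ψ X U₀ t.1 * sieveWt ψ R t.2.1 * sieveWt ψ R t.2.2 with hc
  set F : ℕ × ℕ × ℕ → ℕ → ℝ := fun t n => if tripleLcm t ∣ n + h₁ then realChar χ ((n + h₁) / t.1) else 0 with hF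
  set G : ℕ × ℕ × ℕ → ℕ → ℝ := fun t n => if tripleLcm t ∣ n + h₂ then realChar χ ((n + h₂) / t.1) else 0 with hG
  have hexp : ∑ n ∈ Icc 1 x, (sharpA χ φ ψ X U₀ Bmax (n + h₁) * selbergSieve ψ R (n + h₁)) *
      (sharpA χ φ ψ X U₀ Bmax (n + h₂) * selbergSieve ψ R (n + h₂)) =
      ∑ n ∈ Icc 1 x, (∑ t₁ ∈ T, c t₁ * F t₁ n) * (∑ t₂ ∈ T, c t₂ * G t₂ n) := by
    refine sum_congr rfl fun n hn => ?_
    rw [mem_Icc] at hn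
    rw [sharpA_mul_selbergSieve_eq χ φ hψ X U₀ hR Bmax (by omega : n + h₁ ≠ 0),
      sharpA_mul_selbergSieve_eq χ φ hψ X U₀ hR Bmax (by omega : n + h₂ ≠ 0)]
  rw [hexp, sum_mul_sum_eq_sum_sum]
  have hcb : ∀ t ∈ T, |c t| ≤ Cc * Bψ ^ 2 := by
    intro t ht
    obtain ⟨h1, -, -, -⟩ := one_le_of_mem_sharpTriples ht
    simp only [hc]
    rw [abs_mul, abs_mul]
    calc |sharpLogCoeff φ ψ X U₀ t.1| * |sieveWt ψ R t.2.1| * |sieveWt ψ R t.2.2| ≤ Cc * Bψ * Bψ :=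
          mul_le_mul (mul_le_mul (hCc _ h1) (abs_sieveWt_le hBψ R _) (abs_nonneg _) hCc0)
            (abs_sieveWt_le hBψ R _) (abs_nonneg _) (by positivity)
      _ = Cc * Bψ ^ 2 := by ring
  refine abs_cross_le hq T T c c (fun t₁ t₂ => ∑ n ∈ Icc 1 x, F t₁ n * G t₂ n) hK (by positivity) (by positivity)
    (Nat.cast_nonneg x) hcb hcb (fun t ht => (one_le_of_mem_sharpTriples ht).2.2.2)
    (fun t ht => (one_le_of_mem_sharpTriples ht).2.2.2) fun t₁ ht₁ t₂ ht₂ => ?_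
  obtain ⟨-, -, -, hL1⟩ := one_le_of_mem_sharpTriples ht₁
  obtain ⟨-, -, -, hL2⟩ := one_le_of_mem_sharpTriples ht₂
  have hF : ∀ n, F t₁ n * G t₂ n = if tripleLcm t₁ ∣ n + h₁ ∧ tripleLcm t₂ ∣ n + h₂ then
      realChar χ ((n + h₁) / t₁.1) * realChar χ ((n + h₂) / t₂.1) else 0 := fun n => by
    simp only [hF, hG]; rw [ite_zero_mul_ite_zero]
  simp_rw [hF]
  exact h37 _ _ _ _ hL1 hL2 (Nat.dvd_lcm_left _ _) (Nat.dvd_lcm_left _ _)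

/-- **The `AB` term**: with a Lemma 3.7–type bound `K` for `J = {h₁}` (all lengths `N ≤ x`) and
summation by parts in the second slot,
`|∑_{n ≤ x} (Aν)(n+h₁)(Bν)(n+h₂)| ≤ (C_c B_ψ²) B_ψ² (K_Ψ K) ((x/q) S_A S_B + √q #T_A #T_B)`,
`K_Ψ = sup|ψ| (X+2)² (sup|φ| + 17 sup|φ'|)`. [cite: TaoTeravainen2021, §8] -/
theorem abs_crossAB_le (χ : DirichletCharacter ℂ q) [NeZero q] {φ ψ : ℝ → ℝ} (hφ : IsBump φ)
    (hψ : IsSmoothCutoff ψ) {B₀ B₁ Bψ : ℝ} (hB₀ : ∀ u, |φ u| ≤ B₀) (hB₁ : ∀ u, |deriv φ u| ≤ B₁)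
    (hBψ : ∀ u, |ψ u| ≤ Bψ) {X U₀ : ℝ} (hU₀ : 2 ≤ U₀) (hUX : U₀ ≤ X + 2) {Cc : ℝ} (hCc0 : 0 ≤ Cc)
    (hCc : ∀ b : ℕ, 1 ≤ b → |sharpLogCoeff φ ψ X U₀ b| ≤ Cc) {R : ℝ} (hR : 1 < R) {x h₁ h₂ : ℕ}
    (hxX : Real.log ((x + h₂ : ℕ) : ℝ) ≤ X + 1) (Bmax Dmax : ℕ) {K : ℝ} (hK : 0 ≤ K)
    (h37 : ∀ (N L₁ L₂ b₁ : ℕ), 1 ≤ L₁ → 1 ≤ L₂ → b₁ ∣ L₁ →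
      |∑ n ∈ Icc 1 N, (if L₁ ∣ n + h₁ ∧ L₂ ∣ n + h₂ then realChar χ ((n + h₁) / b₁) else 0)| ≤
        K * Real.sqrt (Nat.gcd (L₁ * L₂) q) * ((N : ℝ) / ((q : ℝ) * L₁ * L₂) + 1)) :
    |∑ n ∈ Icc 1 x, (sharpA χ φ ψ X U₀ Bmax (n + h₁) * selbergSieve ψ R (n + h₁)) *
        (sharpB χ φ ψ X U₀ Dmax (n + h₂) * selbergSieve ψ R (n + h₂))| ≤
      (Cc * Bψ ^ 2) * (Bψ ^ 2) * (Bψ * (X + 2) ^ 2 * (B₀ + 17 * B₁) * K) *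
        ((x : ℝ) / q * tripleGcdSum q (sharpTriples R Bmax) * tripleGcdSum q (sharpTriples R Dmax) +
          Real.sqrt q * #(sharpTriples R Bmax) * #(sharpTriples R Dmax)) := by
  have hq : q ≠ 0 := NeZero.ne q
  have hq0 : (0 : ℝ) < q := by exact_mod_cast Nat.pos_of_ne_zero hq
  have hBψ0 : 0 ≤ Bψ := (abs_nonneg _).trans (hBψ 0)
  have hB₀0 : 0 ≤ B₀ := (abs_nonneg _).trans (hB₀ 0)
  have hB₁0 : 0 ≤ B₁ := (abs_nonneg _).trans (hB₁ 0)
  have hX2 : 0 ≤ X + 2 := by linarith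
  set TA := sharpTriples R Bmax with hTA
  set TB := sharpTriples R Dmax with hTB
  set c₁ : ℕ × ℕ × ℕ → ℝ := fun t => sharpLogCoeff φ ψ X U₀ t.1 * sieveWt ψ R t.2.1 * sieveWt ψ R t.2.2 with hc₁
  set c₂ : ℕ × ℕ × ℕ → ℝ := fun t => realChar χ t.1 * sieveWt ψ R t.2.1 * sieveWt ψ R t.2.2 with hc₂
  set F : ℕ × ℕ × ℕ → ℕ → ℝ := fun t n => if tripleLcm t ∣ n + h₁ then realChar χ ((n + h₁) / t.1) else 0 with hF
  set G : ℕ × ℕ × ℕ → ℕ → ℝ := fun t n => (if tripleLcm t ∣ n + h₂ then (1 : ℝ) else 0) *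
    psiSharp φ ψ X U₀ (((n + h₂ : ℕ) : ℝ) / t.1) with hG
  have hexp : ∑ n ∈ Icc 1 x, (sharpA χ φ ψ X U₀ Bmax (n + h₁) * selbergSieve ψ R (n + h₁)) *
      (sharpB χ φ ψ X U₀ Dmax (n + h₂) * selbergSieve ψ R (n + h₂)) =
      ∑ n ∈ Icc 1 x, (∑ t₁ ∈ TA, c₁ t₁ * F t₁ n) * (∑ t₂ ∈ TB, c₂ t₂ * G t₂ n) := by
    refine sum_congr rfl fun n hn => ?_
    rw [mem_Icc] at hn
    rw [sharpA_mul_selbergSieve_eq χ φ hψ X U₀ hR Bmax (by omega : n + h₁ ≠ 0),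
      sharpB_mul_selbergSieve_eq χ φ hψ X U₀ hR Dmax (by omega : n + h₂ ≠ 0)]
  rw [hexp, sum_mul_sum_eq_sum_sum]
  have hcb₁ : ∀ t ∈ TA, |c₁ t| ≤ Cc * Bψ ^ 2 := by
    intro t ht
    obtain ⟨h1, -, -, -⟩ := one_le_of_mem_sharpTriples ht
    simp only [hc₁]
    rw [abs_mul, abs_mul]
    calc |sharpLogCoeff φ ψ X U₀ t.1| * |sieveWt ψ R t.2.1| * |sieveWt ψ R t.2.2| ≤ Cc * Bψ * Bψ :=
          mul_le_mul (mul_le_mul (hCc _ h1) (abs_sieveWt_le hBψ R _) (abs_nonneg _) hCc0)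
            (abs_sieveWt_le hBψ R _) (abs_nonneg _) (by positivity)
      _ = Cc * Bψ ^ 2 := by ring
  have hcb₂ : ∀ t ∈ TB, |c₂ t| ≤ Bψ ^ 2 := by
    intro t _
    simp only [hc₂]
    rw [abs_mul, abs_mul]
    calc |realChar χ t.1| * |sieveWt ψ R t.2.1| * |sieveWt ψ R t.2.2| ≤ 1 * Bψ * Bψ :=
          mul_le_mul (mul_le_mul (abs_realChar_le_one χ _) (abs_sieveWt_le hBψ R _) (abs_nonneg _) zero_le_one)
            (abs_sieveWt_le hBψ R _) (abs_nonneg _) (by positivity)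
      _ = Bψ ^ 2 := by ring
  refine abs_cross_le hq TA TB c₁ c₂ (fun t₁ t₂ => ∑ n ∈ Icc 1 x, F t₁ n * G t₂ n) (by positivity)
    (by positivity) (by positivity) (Nat.cast_nonneg x) hcb₁ hcb₂
    (fun t ht => (one_le_of_mem_sharpTriples ht).2.2.2)
    (fun t ht => (one_le_of_mem_sharpTriples ht).2.2.2) fun t₁ ht₁ t₂ ht₂ => ?_
  obtain ⟨-, -, -, hL1⟩ := one_le_of_mem_sharpTriples ht₁
  obtain ⟨hd1, -, -, hL2⟩ := one_le_of_mem_sharpTriples ht₂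
  -- `F G = a_n Ψ((n+h₂)/d)` with `a_n = 1_{…} χ((n+h₁)/b₁)`
  have hFG : ∀ n, F t₁ n * G t₂ n = (if tripleLcm t₁ ∣ n + h₁ ∧ tripleLcm t₂ ∣ n + h₂ then
      realChar χ ((n + h₁) / t₁.1) else 0) * psiSharp φ ψ X U₀ (((n + h₂ : ℕ) : ℝ) / t₂.1) := fun n => by
    simp only [hF, hG]
    rw [← mul_assoc, ite_zero_mul_ite_zero, mul_one]
  simp_rw [hFG]
  set M : ℝ := K * Real.sqrt (Nat.gcd (tripleLcm t₁ * tripleLcm t₂) q) *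
    ((x : ℝ) / ((q : ℝ) * tripleLcm t₁ * tripleLcm t₂) + 1) with hM
  have hM0 : 0 ≤ M := by positivity
  have hpart : ∀ N' ∈ Icc 1 x, |∑ n ∈ Icc 1 N', (if tripleLcm t₁ ∣ n + h₁ ∧ tripleLcm t₂ ∣ n + h₂ then
      realChar χ ((n + h₁) / t₁.1) else 0)| ≤ M := by
    intro N' hN'
    rw [mem_Icc] at hN'
    refine (h37 N' _ _ _ hL1 hL2 (Nat.dvd_lcm_left _ _)).trans ?_
    rw [hM]
    have hN'x : (N' : ℝ) ≤ x := by exact_mod_cast hN'.2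
    have hL0 : (0 : ℝ) < (q : ℝ) * tripleLcm t₁ * tripleLcm t₂ := by
      have : (1 : ℝ) ≤ tripleLcm t₁ := by exact_mod_cast hL1
      have : (1 : ℝ) ≤ tripleLcm t₂ := by exact_mod_cast hL2
      positivity
    gcongr
  calc |∑ n ∈ Icc 1 x, (if tripleLcm t₁ ∣ n + h₁ ∧ tripleLcm t₂ ∣ n + h₂ then
        realChar χ ((n + h₁) / t₁.1) else 0) * psiSharp φ ψ X U₀ (((n + h₂ : ℕ) : ℝ) / t₂.1)|
      ≤ Bψ * (X + 2) ^ 2 * (B₀ + 17 * B₁) * M :=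
        abs_sum_mul_psiSharp_le hφ hψ hB₀ hB₁ hBψ hU₀ hUX h₂ hxX hd1 hM0 hpart
    _ = _ := by rw [hM]; ring

/-- **The `BA` term**: with a Lemma 3.7–type bound `K` for `J = {h₂}` (all lengths `N ≤ x`) and
summation by parts in the first slot,
`|∑_{n ≤ x} (Bν)(n+h₁)(Aν)(n+h₂)| ≤ B_ψ² (C_c B_ψ²) (K_Ψ K) ((x/q) S_B S_A + √q #T_B #T_A)`.
[cite: TaoTeravainen2021, §8] -/
theorem abs_crossBA_le (χ : DirichletCharacter ℂ q) [NeZero q] {φ ψ : ℝ → ℝ} (hφ : IsBump φ)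
    (hψ : IsSmoothCutoff ψ) {B₀ B₁ Bψ : ℝ} (hB₀ : ∀ u, |φ u| ≤ B₀) (hB₁ : ∀ u, |deriv φ u| ≤ B₁)
    (hBψ : ∀ u, |ψ u| ≤ Bψ) {X U₀ : ℝ} (hU₀ : 2 ≤ U₀) (hUX : U₀ ≤ X + 2) {Cc : ℝ} (hCc0 : 0 ≤ Cc)
    (hCc : ∀ b : ℕ, 1 ≤ b → |sharpLogCoeff φ ψ X U₀ b| ≤ Cc) {R : ℝ} (hR : 1 < R) {x h₁ h₂ : ℕ}
    (hxX : Real.log ((x + h₁ : ℕ) : ℝ) ≤ X + 1) (Bmax Dmax : ℕ) {K : ℝ} (hK : 0 ≤ K)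
    (h37 : ∀ (N L₁ L₂ b₂ : ℕ), 1 ≤ L₁ → 1 ≤ L₂ → b₂ ∣ L₂ →
      |∑ n ∈ Icc 1 N, (if L₁ ∣ n + h₁ ∧ L₂ ∣ n + h₂ then realChar χ ((n + h₂) / b₂) else 0)| ≤
        K * Real.sqrt (Nat.gcd (L₁ * L₂) q) * ((N : ℝ) / ((q : ℝ) * L₁ * L₂) + 1)) :
    |∑ n ∈ Icc 1 x, (sharpB χ φ ψ X U₀ Dmax (n + h₁) * selbergSieve ψ R (n + h₁)) *
        (sharpA χ φ ψ X U₀ Bmax (n + h₂) * selbergSieve ψ R (n + h₂))| ≤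
      (Bψ ^ 2) * (Cc * Bψ ^ 2) * (Bψ * (X + 2) ^ 2 * (B₀ + 17 * B₁) * K) *
        ((x : ℝ) / q * tripleGcdSum q (sharpTriples R Dmax) * tripleGcdSum q (sharpTriples R Bmax) +
          Real.sqrt q * #(sharpTriples R Dmax) * #(sharpTriples R Bmax)) := by
  have hq : q ≠ 0 := NeZero.ne q
  have hq0 : (0 : ℝ) < q := by exact_mod_cast Nat.pos_of_ne_zero hq
  have hBψ0 : 0 ≤ Bψ := (abs_nonneg _).trans (hBψ 0)
  have hB₀0 : 0 ≤ B₀ := (abs_nonneg _).trans (hB₀ 0)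
  have hB₁0 : 0 ≤ B₁ := (abs_nonneg _).trans (hB₁ 0)
  have hX2 : 0 ≤ X + 2 := by linarith
  set TA := sharpTriples R Bmax with hTA
  set TB := sharpTriples R Dmax with hTB
  set c₁ : ℕ × ℕ × ℕ → ℝ := fun t => realChar χ t.1 * sieveWt ψ R t.2.1 * sieveWt ψ R t.2.2 with hc₁
  set c₂ : ℕ × ℕ × ℕ → ℝ := fun t => sharpLogCoeff φ ψ X U₀ t.1 * sieveWt ψ R t.2.1 * sieveWt ψ R t.2.2 with hc₂
  set F : ℕ × ℕ × ℕ → ℕ → ℝ := fun t n => (if tripleLcm t ∣ n + h₁ then (1 : ℝ) else 0) *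
    psiSharp φ ψ X U₀ (((n + h₁ : ℕ) : ℝ) / t.1) with hF
  set G : ℕ × ℕ × ℕ → ℕ → ℝ := fun t n => if tripleLcm t ∣ n + h₂ then realChar χ ((n + h₂) / t.1) else 0 with hG
  have hexp : ∑ n ∈ Icc 1 x, (sharpB χ φ ψ X U₀ Dmax (n + h₁) * selbergSieve ψ R (n + h₁)) *
      (sharpA χ φ ψ X U₀ Bmax (n + h₂) * selbergSieve ψ R (n + h₂)) =
      ∑ n ∈ Icc 1 x, (∑ t₁ ∈ TB, c₁ t₁ * F t₁ n) * (∑ t₂ ∈ TA, c₂ t₂ * G t₂ n) := by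
    refine sum_congr rfl fun n hn => ?_
    rw [mem_Icc] at hn
    rw [sharpB_mul_selbergSieve_eq χ φ hψ X U₀ hR Dmax (by omega : n + h₁ ≠ 0),
      sharpA_mul_selbergSieve_eq χ φ hψ X U₀ hR Bmax (by omega : n + h₂ ≠ 0)]
  rw [hexp, sum_mul_sum_eq_sum_sum]
  have hcb₂ : ∀ t ∈ TA, |c₂ t| ≤ Cc * Bψ ^ 2 := by
    intro t ht
    obtain ⟨h1, -, -, -⟩ := one_le_of_mem_sharpTriples ht
    simp only [hc₂]
    rw [abs_mul, abs_mul]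
    calc |sharpLogCoeff φ ψ X U₀ t.1| * |sieveWt ψ R t.2.1| * |sieveWt ψ R t.2.2| ≤ Cc * Bψ * Bψ :=
          mul_le_mul (mul_le_mul (hCc _ h1) (abs_sieveWt_le hBψ R _) (abs_nonneg _) hCc0)
            (abs_sieveWt_le hBψ R _) (abs_nonneg _) (by positivity)
      _ = Cc * Bψ ^ 2 := by ring
  have hcb₁ : ∀ t ∈ TB, |c₁ t| ≤ Bψ ^ 2 := by
    intro t _
    simp only [hc₁]
    rw [abs_mul, abs_mul]
    calc |realChar χ t.1| * |sieveWt ψ R t.2.1| * |sieveWt ψ R t.2.2| ≤ 1 * Bψ * Bψ :=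
          mul_le_mul (mul_le_mul (abs_realChar_le_one χ _) (abs_sieveWt_le hBψ R _) (abs_nonneg _) zero_le_one)
            (abs_sieveWt_le hBψ R _) (abs_nonneg _) (by positivity)
      _ = Bψ ^ 2 := by ring
  refine abs_cross_le hq TB TA c₁ c₂ (fun t₁ t₂ => ∑ n ∈ Icc 1 x, F t₁ n * G t₂ n) (by positivity)
    (by positivity) (by positivity) (Nat.cast_nonneg x) hcb₁ hcb₂
    (fun t ht => (one_le_of_mem_sharpTriples ht).2.2.2)
    (fun t ht => (one_le_of_mem_sharpTriples ht).2.2.2) fun t₁ ht₁ t₂ ht₂ => ?_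
  obtain ⟨hd1, -, -, hL1⟩ := one_le_of_mem_sharpTriples ht₁
  obtain ⟨-, -, -, hL2⟩ := one_le_of_mem_sharpTriples ht₂
  have hFG : ∀ n, F t₁ n * G t₂ n = (if tripleLcm t₁ ∣ n + h₁ ∧ tripleLcm t₂ ∣ n + h₂ then
      realChar χ ((n + h₂) / t₂.1) else 0) * psiSharp φ ψ X U₀ (((n + h₁ : ℕ) : ℝ) / t₁.1) := fun n => by
    simp only [hF, hG]
    rw [mul_right_comm, ite_zero_mul_ite_zero, one_mul]
  simp_rw [hFG]
  set M : ℝ := K * Real.sqrt (Nat.gcd (tripleLcm t₁ * tripleLcm t₂) q) *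
    ((x : ℝ) / ((q : ℝ) * tripleLcm t₁ * tripleLcm t₂) + 1) with hM
  have hM0 : 0 ≤ M := by positivity
  have hpart : ∀ N' ∈ Icc 1 x, |∑ n ∈ Icc 1 N', (if tripleLcm t₁ ∣ n + h₁ ∧ tripleLcm t₂ ∣ n + h₂ then
      realChar χ ((n + h₂) / t₂.1) else 0)| ≤ M := by
    intro N' hN'
    rw [mem_Icc] at hN'
    refine (h37 N' _ _ _ hL1 hL2 (Nat.dvd_lcm_left _ _)).trans ?_
    rw [hM]
    have hN'x : (N' : ℝ) ≤ x := by exact_mod_cast hN'.2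
    have hL0 : (0 : ℝ) < (q : ℝ) * tripleLcm t₁ * tripleLcm t₂ := by
      have : (1 : ℝ) ≤ tripleLcm t₁ := by exact_mod_cast hL1
      have : (1 : ℝ) ≤ tripleLcm t₂ := by exact_mod_cast hL2
      positivity
    gcongr
  calc |∑ n ∈ Icc 1 x, (if tripleLcm t₁ ∣ n + h₁ ∧ tripleLcm t₂ ∣ n + h₂ then
        realChar χ ((n + h₂) / t₂.1) else 0) * psiSharp φ ψ X U₀ (((n + h₁ : ℕ) : ℝ) / t₁.1)|
      ≤ Bψ * (X + 2) ^ 2 * (B₀ + 17 * B₁) * M :=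
        abs_sum_mul_psiSharp_le hφ hψ hB₀ hB₁ hBψ hU₀ hUX h₁ hxX hd1 hM0 hpart
    _ = _ := by rw [hM]; ring


/-! ### Sizes of the triple sums, and the conclusion -/

/-- `[b,[e,e']] ≤ N ⌈R⌉²` on `sharpTriples R N`. [folklore] -/
theorem tripleLcm_le_of_mem_sharpTriples {R : ℝ} {N : ℕ} {t : ℕ × ℕ × ℕ} (ht : t ∈ sharpTriples R N) :
    tripleLcm t ≤ N * ⌈R⌉₊ ^ 2 := by
  have ht' := ht
  rw [mem_sharpTriples] at ht
  unfold sharpTriples at ht'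
  rw [mem_product, mem_product, mem_Icc, sieveRange, mem_Ico, mem_Ico] at ht'
  obtain ⟨⟨hb1, hbN⟩, ⟨he1, heR⟩, ⟨he1', heR'⟩⟩ := ht'
  have h1 : Nat.lcm t.2.1 t.2.2 ≤ t.2.1 * t.2.2 :=
    Nat.le_of_dvd (Nat.mul_pos (by omega) (by omega)) (Nat.lcm_dvd_mul _ _)
  have h2 : tripleLcm t ≤ t.1 * Nat.lcm t.2.1 t.2.2 := by
    unfold tripleLcm
    exact Nat.le_of_dvd (Nat.mul_pos (by omega) (Nat.pos_of_ne_zero (Nat.lcm_ne_zero (by omega) (by omega))))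
      (Nat.lcm_dvd_mul _ _)
  calc tripleLcm t ≤ t.1 * Nat.lcm t.2.1 t.2.2 := h2
    _ ≤ N * (⌈R⌉₊ * ⌈R⌉₊) := Nat.mul_le_mul hbN (h1.trans (Nat.mul_le_mul (by omega) (by omega)))
    _ = N * ⌈R⌉₊ ^ 2 := by ring

/-- **`S(T_N) ≤ τ(q)⁴ (1 + log(N⌈R⌉²))⁸`** (`q ≠ 0`). [cite: TaoTeravainen2021, §8] -/
theorem tripleGcdSum_sharpTriples_le {q : ℕ} (hq : q ≠ 0) (R : ℝ) (N : ℕ) :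
    tripleGcdSum q (sharpTriples R N) ≤
      ((#q.divisors : ℕ) : ℝ) ^ 4 * (1 + Real.log ((N * ⌈R⌉₊ ^ 2 : ℕ) : ℝ)) ^ 8 := by
  unfold tripleGcdSum
  refine (sum_triples_sqrt_gcd_div_lcm_le q _ (Y := N * ⌈R⌉₊ ^ 2) fun t ht => ?_).trans
    (sum_tau_cube_sqrt_gcd_div_le hq _)
  obtain ⟨h1, h2, h3, -⟩ := one_le_of_mem_sharpTriples ht
  exact ⟨h1, h2, h3, tripleLcm_le_of_mem_sharpTriples ht⟩

/-- `#T_N ≤ N R²` (`R ≥ 0`). [folklore] -/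
theorem card_sharpTriples_le {R : ℝ} (hR : 0 ≤ R) (N : ℕ) : (#(sharpTriples R N) : ℝ) ≤ N * R ^ 2 := by
  unfold sharpTriples
  rw [card_product, card_product, Nat.card_Icc, Nat.add_sub_cancel]
  push_cast
  have h := card_sieveRange_le hR
  have h0 : (0 : ℝ) ≤ #(sieveRange R) := Nat.cast_nonneg _
  calc (N : ℝ) * ((#(sieveRange R) : ℝ) * #(sieveRange R)) ≤ N * (R * R) := by gcongr
    _ = N * R ^ 2 := by ring

/-- `C_c := sup|φ| (2(U₀+2) + (1+sup|ψ|) X²)`, the bound for `|c_b|` of `abs_sharpLogCoeff_le`.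
[cite: TaoTeravainen2021, §8 ("`c_d ≪ log^{O(1)} x`")] -/
def sharpCoeffBound (B₀ Bψ X U₀ : ℝ) : ℝ := B₀ * (2 * (U₀ + 2) + (1 + Bψ) * X ^ 2)

/-- `K_Ψ := sup|ψ| (X+2)² (sup|φ| + 17 sup|φ'|)`, the constant of `abs_sum_mul_psiSharp_le`.
[cite: TaoTeravainen2021, §8 ("`‖Ψ‖_TV ≪ log^{O(1)} x`")] -/
def psiAbelConst (B₀ B₁ Bψ X : ℝ) : ℝ := Bψ * (X + 2) ^ 2 * (B₀ + 17 * B₁)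

/-- **The `χ`-twisted Type I terms are negligible** (`k = 2`): with the three Lemma 3.7–type bounds
`K_b` (`J = {h₁,h₂}`), `K_l` (`J = {h₁}`), `K_r` (`J = {h₂}`) — in the application
`K = C_ε q^{1/2+ε}` from `lemma37_pair_both/left/right` — and `B_max`, `D_max` covering the supports,
`|∑_{n ≤ x} Λ♯(n+h₁)Λ♯(n+h₂) - ∑_{n ≤ x} (Bν)(n+h₁)(Bν)(n+h₂)|
 ≤ (C_cB_ψ²)² K_b P_{AA} + C_cB_ψ⁴ K_Ψ K_l P_{AB} + C_cB_ψ⁴ K_Ψ K_r P_{BA}`,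
`P_{UV} = (x/q) S_U S_V + √q #T_U #T_V`, `C_c = sup|φ|(2(U₀+2) + (1+sup|ψ|)X²)`,
`K_Ψ = sup|ψ|(X+2)²(sup|φ| + 17 sup|φ'|)`. [cite: TaoTeravainen2021, §8 (disposal of the
`g_{d,d'}` contributions)] -/
theorem abs_sharpCorr_sub_smooth_le (χ : DirichletCharacter ℂ q) [NeZero q] {φ ψ : ℝ → ℝ} (hφ : IsBump φ)
    (hψ : IsSmoothCutoff ψ) {B₀ B₁ Bψ : ℝ} (hB₀ : ∀ u, |φ u| ≤ B₀) (hB₁ : ∀ u, |deriv φ u| ≤ B₁)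
    (hBψ : ∀ u, |ψ u| ≤ Bψ) {X U₀ : ℝ} (hU₀ : 2 ≤ U₀) (hX : 2 * U₀ ≤ X) {R : ℝ} (hR : 1 < R)
    {x h₁ h₂ : ℕ} (hxX₁ : Real.log ((x + h₁ : ℕ) : ℝ) ≤ X + 1) (hxX₂ : Real.log ((x + h₂ : ℕ) : ℝ) ≤ X + 1)
    {Bmax Dmax : ℕ} (hBmax : ∀ b : ℕ, Bmax < b → U₀ + 1 ≤ Real.log b)
    (hD₁ : ∀ n ∈ Icc 1 x, ∀ d ∈ (n + h₁).divisors, Dmax < d →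
      Real.log (((n + h₁ : ℕ) : ℝ) / d) ≤ X - 2 * U₀ - 1)
    (hD₂ : ∀ n ∈ Icc 1 x, ∀ d ∈ (n + h₂).divisors, Dmax < d →
      Real.log (((n + h₂ : ℕ) : ℝ) / d) ≤ X - 2 * U₀ - 1)
    {Kb Kl Kr : ℝ} (hKb : 0 ≤ Kb) (hKl : 0 ≤ Kl) (hKr : 0 ≤ Kr)
    (h37b : ∀ (L₁ L₂ b₁ b₂ : ℕ), 1 ≤ L₁ → 1 ≤ L₂ → b₁ ∣ L₁ → b₂ ∣ L₂ →
      |∑ n ∈ Icc 1 x, (if L₁ ∣ n + h₁ ∧ L₂ ∣ n + h₂ then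
          realChar χ ((n + h₁) / b₁) * realChar χ ((n + h₂) / b₂) else 0)| ≤
        Kb * Real.sqrt (Nat.gcd (L₁ * L₂) q) * ((x : ℝ) / ((q : ℝ) * L₁ * L₂) + 1))
    (h37l : ∀ (N L₁ L₂ b₁ : ℕ), 1 ≤ L₁ → 1 ≤ L₂ → b₁ ∣ L₁ →
      |∑ n ∈ Icc 1 N, (if L₁ ∣ n + h₁ ∧ L₂ ∣ n + h₂ then realChar χ ((n + h₁) / b₁) else 0)| ≤
        Kl * Real.sqrt (Nat.gcd (L₁ * L₂) q) * ((N : ℝ) / ((q : ℝ) * L₁ * L₂) + 1))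
    (h37r : ∀ (N L₁ L₂ b₂ : ℕ), 1 ≤ L₁ → 1 ≤ L₂ → b₂ ∣ L₂ →
      |∑ n ∈ Icc 1 N, (if L₁ ∣ n + h₁ ∧ L₂ ∣ n + h₂ then realChar χ ((n + h₂) / b₂) else 0)| ≤
        Kr * Real.sqrt (Nat.gcd (L₁ * L₂) q) * ((N : ℝ) / ((q : ℝ) * L₁ * L₂) + 1)) :
    |∑ n ∈ Icc 1 x, vonMangoldtSiegelSharp χ φ ψ X U₀ R (n + h₁) * vonMangoldtSiegelSharp χ φ ψ X U₀ R (n + h₂) -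
        ∑ n ∈ Icc 1 x, (sharpB χ φ ψ X U₀ Dmax (n + h₁) * selbergSieve ψ R (n + h₁)) *
          (sharpB χ φ ψ X U₀ Dmax (n + h₂) * selbergSieve ψ R (n + h₂))| ≤
      (sharpCoeffBound B₀ Bψ X U₀ * Bψ ^ 2) * (sharpCoeffBound B₀ Bψ X U₀ * Bψ ^ 2) * Kb *
          ((x : ℝ) / q * tripleGcdSum q (sharpTriples R Bmax) * tripleGcdSum q (sharpTriples R Bmax) +
            Real.sqrt q * #(sharpTriples R Bmax) * #(sharpTriples R Bmax)) +
        (sharpCoeffBound B₀ Bψ X U₀ * Bψ ^ 2) * (Bψ ^ 2) * (psiAbelConst B₀ B₁ Bψ X * Kl) *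
          ((x : ℝ) / q * tripleGcdSum q (sharpTriples R Bmax) * tripleGcdSum q (sharpTriples R Dmax) +
            Real.sqrt q * #(sharpTriples R Bmax) * #(sharpTriples R Dmax)) +
        (Bψ ^ 2) * (sharpCoeffBound B₀ Bψ X U₀ * Bψ ^ 2) * (psiAbelConst B₀ B₁ Bψ X * Kr) *
          ((x : ℝ) / q * tripleGcdSum q (sharpTriples R Dmax) * tripleGcdSum q (sharpTriples R Bmax) +
            Real.sqrt q * #(sharpTriples R Dmax) * #(sharpTriples R Bmax)) := by
  have hU₀' : 0 < U₀ := by linarith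
  have hUX : U₀ ≤ X + 2 := by linarith
  have hB₀0 : 0 ≤ B₀ := (abs_nonneg _).trans (hB₀ 0)
  have hBψ0 : 0 ≤ Bψ := (abs_nonneg _).trans (hBψ 0)
  have hCc0 : 0 ≤ sharpCoeffBound B₀ Bψ X U₀ := by
    have : 0 ≤ X := by linarith
    unfold sharpCoeffBound; positivity
  have hCc : ∀ b : ℕ, 1 ≤ b → |sharpLogCoeff φ ψ X U₀ b| ≤ sharpCoeffBound B₀ Bψ X U₀ := fun b hb =>
    abs_sharpLogCoeff_le hφ hB₀ hBψ hU₀' hX hb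
  -- split `Λ♯ = (A + B)ν` in both slots
  have hsplit : ∀ n ∈ Icc 1 x,
      vonMangoldtSiegelSharp χ φ ψ X U₀ R (n + h₁) * vonMangoldtSiegelSharp χ φ ψ X U₀ R (n + h₂) =
      (sharpA χ φ ψ X U₀ Bmax (n + h₁) * selbergSieve ψ R (n + h₁)) *
          (sharpA χ φ ψ X U₀ Bmax (n + h₂) * selbergSieve ψ R (n + h₂)) +
        (sharpA χ φ ψ X U₀ Bmax (n + h₁) * selbergSieve ψ R (n + h₁)) *
          (sharpB χ φ ψ X U₀ Dmax (n + h₂) * selbergSieve ψ R (n + h₂)) +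
        (sharpB χ φ ψ X U₀ Dmax (n + h₁) * selbergSieve ψ R (n + h₁)) *
          (sharpA χ φ ψ X U₀ Bmax (n + h₂) * selbergSieve ψ R (n + h₂)) +
        (sharpB χ φ ψ X U₀ Dmax (n + h₁) * selbergSieve ψ R (n + h₁)) *
          (sharpB χ φ ψ X U₀ Dmax (n + h₂) * selbergSieve ψ R (n + h₂)) := by
    intro n hn
    have hn' := hn
    rw [mem_Icc] at hn
    have hlog₁ : Real.log ((n + h₁ : ℕ) : ℝ) ≤ X + U₀ - 1 := by
      have : Real.log ((n + h₁ : ℕ) : ℝ) ≤ Real.log ((x + h₁ : ℕ) : ℝ) :=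
        Real.log_le_log (by exact_mod_cast (show 0 < n + h₁ by omega)) (by exact_mod_cast (show n + h₁ ≤ x + h₁ by omega))
      linarith
    have hlog₂ : Real.log ((n + h₂ : ℕ) : ℝ) ≤ X + U₀ - 1 := by
      have : Real.log ((n + h₂ : ℕ) : ℝ) ≤ Real.log ((x + h₂ : ℕ) : ℝ) :=
        Real.log_le_log (by exact_mod_cast (show 0 < n + h₂ by omega)) (by exact_mod_cast (show n + h₂ ≤ x + h₂ by omega))
      linarith
    unfold vonMangoldtSiegelSharp
    rw [sharpLog_eq_sharpA_add_sharpB χ hφ hψ hU₀' hX (by omega) hlog₁ hBmax (hD₁ n hn'),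
      sharpLog_eq_sharpA_add_sharpB χ hφ hψ hU₀' hX (by omega) hlog₂ hBmax (hD₂ n hn')]
    ring
  rw [sum_congr rfl hsplit, sum_add_distrib, sum_add_distrib, sum_add_distrib, add_sub_cancel_right]
  have hAA := abs_crossAA_le χ φ hψ hBψ X U₀ hCc0 hCc hR x Bmax hKb h37b
  have hAB := abs_crossAB_le χ hφ hψ hB₀ hB₁ hBψ hU₀ hUX hCc0 hCc hR hxX₂ Bmax Dmax hKl h37l
  have hBA := abs_crossBA_le χ hφ hψ hB₀ hB₁ hBψ hU₀ hUX hCc0 hCc hR hxX₁ Bmax Dmax hKr h37r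
  change _ ≤ _ + (sharpCoeffBound B₀ Bψ X U₀ * Bψ ^ 2) * (Bψ ^ 2) * (Bψ * (X + 2) ^ 2 * (B₀ + 17 * B₁) * Kl) * _ +
    (Bψ ^ 2) * (sharpCoeffBound B₀ Bψ X U₀ * Bψ ^ 2) * (Bψ * (X + 2) ^ 2 * (B₀ + 17 * B₁) * Kr) * _
  calc _ ≤ |∑ n ∈ Icc 1 x, (sharpA χ φ ψ X U₀ Bmax (n + h₁) * selbergSieve ψ R (n + h₁)) *
            (sharpA χ φ ψ X U₀ Bmax (n + h₂) * selbergSieve ψ R (n + h₂)) +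
          ∑ n ∈ Icc 1 x, (sharpA χ φ ψ X U₀ Bmax (n + h₁) * selbergSieve ψ R (n + h₁)) *
            (sharpB χ φ ψ X U₀ Dmax (n + h₂) * selbergSieve ψ R (n + h₂))| +
          |∑ n ∈ Icc 1 x, (sharpB χ φ ψ X U₀ Dmax (n + h₁) * selbergSieve ψ R (n + h₁)) *
            (sharpA χ φ ψ X U₀ Bmax (n + h₂) * selbergSieve ψ R (n + h₂))| := abs_add_le _ _
    _ ≤ _ := add_le_add ((abs_add_le _ _).trans (add_le_add hAA hAB)) hBA


end TaoTeravainen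

end Literature.Barriers.Parity
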